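import Summits.BirchSwinnertonDyer.BirchSwinnertonDyer.Theorems.GenusKolyvaginAtTwoExactDescentAtTwoOfFacts
import Summits.BirchSwinnertonDyer.BirchSwinnertonDyer.Theorems.GenusKolyvaginAtTwoExactDescentAtTwoOfFourFacts
import Summits.BirchSwinnertonDyer.BirchSwinnertonDyer.Theorems.GenusOffHabitatResidualAtTwoOfShift

/-!
# Route `GenusKolyvaginAtTwo`, LINE 9 support `ShiftedExactDescentAtTwo` (item stmt-BirchSwinnertonDyer-27470):
# the exact `2`-adic Heegner descent WITH THE TAMAGAWA SHIFT `t = ord₂ ∏ c_q` CARRIED, closed modulo the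
# same FOUR published facts as `ExactDescentAtTwoOfFourFacts` (item 24238)

HONEST FRAMING (cell `bsd-f1-sign2`, width seat `bsd-line-gk2-p4` g10; D-0145 line
`route-BirchSwinnertonDyer-GenusKolyvaginAtTwo`, rev 14, leaf K4 `Rank1Residual.NonCMAtTwo`): THEOREMS ONLY —
no definition, no named fact, nothing asserted; BSD is not proved by this and no class of WALL row 1 is
closed here. Item 27470 is typed WITHOUT named-fact antecedents, while every kernel road to it consumes
STATEMENT-ONLY published facts; what this file proves is the CONDITIONAL closer
**`shiftedExactDescentAtTwo_of_four_facts : GZ(N_E, W, K) ∀(W,K) → GZK → modularity → Milne any-model →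
ShiftedExactDescentAtTwo`** and its bundle `shiftedExactDescentAtTwo_ofFourFacts`, whose antecedent is
VERBATIM the antecedent of the closed item 24238 `ExactDescentAtTwoOfFourFacts` (so a by-name closure of
27470 needs only an `…OfFourFacts` re-typing with that antecedent — planner's verb, as for 22138 → 24238),
together with the UNCONDITIONAL comparison `exactDescentAtTwo_of_shifted : ShiftedExactDescentAtTwo →
ExactDescentAtTwo` (the shifted statement is the stronger one: at `t = 0` it is crux #4 minus its idle
`#Sel₂(Wd) = 2` binder).

The mathematics is Gross–Zagier V.§2 bookkeeping over `K` with `ord₂ ∏_q c_q(E)` CARRIED instead of killed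
by oddness (the refuter's read-back of 27470, cf2-ref g7): for the rank-ZERO member `E` of the Heegner
pair, `y_K = P(1)` descends to a non-torsion `P₀ ∈ E(K)`; `E(K[1])[2^∞] = 0` (`ρ̄_{E,2}` onto, `d_K` odd)
transports `2^{M₀} ∥ y_K` to `ord₂ [E(K) : ℤP₀] = M₀`; Gross–Zagier in Dokchitser–Dokchitser's currency
gives `#Ш_an(E ⊗ K) = 4·I²/(c²·w_K²·(∏_q c_q)²)` EXACTLY (`CMExactDescent.shaAnOverC_baseChange_eq_of_heegner`;
all `q ∣ N` split in `K`, so the Tamagawa product over `K` is `(∏_q c_q)²`), whence with `w_K = 2`, `c` odd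
and `t := ord₂ ∏_q c_q ≤ M₀`: `ord₂ #Ш_an(E ⊗ K) = 2M₀ − 2t = ord₂ #Ш(E ⊗ K)` (the item's exactness INPUT
`#Ш(E_K)[2^∞] = 4^{M₀ − t}`), i.e. `MissingPPartOverCAt (E ⊗ K) 2`; Milne's model-free descent
`AdditivePotMult.bsdp_of_pPartOverC_baseChange` concludes `BSD(E, 2)` from `BSD(Wd, 2)`. The twin's
analytic rank is EXACTLY one from Gross–Zagier + GZK + modularity and `P₀` non-torsion alone
(`analyticRank_twist_eq_one_of_rankZero_of_heegner`: neither Kolyvagin's theorem over `K` nor a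
`#Sel₂(Wd) = 2` binder is used — the shifted item has none).

CONSEQUENCE FOR LINE 9 (census, `offHabitatResidualAtTwo_of_four_facts_of_shiftCruxes`): granted the four
published facts, the residual #5 `OffHabitatResidualAtTwo` follows from J1 `TamagawaDivisibilityAtTwo`, J2
`ShiftedGenusSupplyAtTwo`, J3 `KolyvaginExactAtTwoShifted` and the declared residual R′
`OffShiftedHabitatResidualAtTwo` alone — J4 (this item) is PRINT-COMPLETE and drops out of the glue
`OffHabitatResidualAtTwoOfShift` (item 27472, closed).

References: [GrossZagier1986] I.(6.3), V.§2; [GrossLMS1991] §2 Conj. (2.2), §4 (4.1); [McCallumLMS1991]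
§5 Lemma 5.1; [Milne1972ArithmeticAV] §1 Thm 1; [Miller2011LMS] Def. 1.1; [Darmon2004] Thm. 3.22.
-/

set_option autoImplicit false
-- the Theorems namespace of this sub repeats the summit name by design (D-0017 nested layout)
set_option linter.dupNamespace false

noncomputable section

open scoped Classical

open WeierstrassCurve NumberField Literature.NumberTheory.EllipticCurves
  Literature.NumberTheory.EllipticCurves.ModularForms
  Literature.NumberTheory.EllipticCurves.Rank1Residual
  Literature.NumberTheory.EllipticCurves.Rank1Residual.Typed
  Literature.NumberTheory.EllipticCurves.KrizLi2019
  Summit.BirchSwinnertonDyer.Rank1Residual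
  Summit.BirchSwinnertonDyer.Rank1Residual.AdditivePotMult
  Summit.BirchSwinnertonDyer.BirchSwinnertonDyer.Theorems.CMExactDescent

namespace Summit.BirchSwinnertonDyer.BirchSwinnertonDyer.Theorems.GenusExactDescent

/-! ## §1 The exact `2`-adic Heegner descent with the Tamagawa shift carried -/

/-- **THE EXACT `2`-ADIC HEEGNER DESCENT WITH THE TAMAGAWA SHIFT `t = ord₂ ∏_q c_q(E)` CARRIED**
(CM-free, symmetric in the rank order; `CMExactDescent.bsdp_two_of_card_sha_baseChange_eq_of_facts` is
the case `t = 0`). `W/ℚ` globally minimal of conductor `N` with `ρ̄_{E,2}` onto (`hρ`), `r_an(E) ≤ 1`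
(`hr`); `K` imaginary quadratic with odd `d_K ≠ −3` (so `w_K = 2`) satisfying the Heegner hypothesis for
`N`; `Dt` a parametrisation datum at level `N` with odd Manin constant (`hc`); `d₁` a conductor-`1`
Kolyvagin datum with `2^{M₀} ∥ P(1) = y_K` in `E(K[1])` (`hdiv`, `hndiv`); `ord_{s=1} L(E_K, s) = 1`
(`hrK`); `t := ord₂ ∏_q c_q(E) ≤ M₀` (`ht`) and `#Ш(E_K/K)[2^∞] = 2^{2(M₀ − t)}` (`hsha`); `Wd` a globally
minimal model of `E^{(d_K)}` with `r_an(Wd) ≤ 1` and `BSD(Wd, 2)`. PUBLISHED inputs as binders: `hGZ`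
(Gross–Zagier at `(N, W, K)`), `hGZK`, `hmod`, `hMilneC`. CONCLUSION: `BSD(W, 2)`. Proof: `P(1)` descends
to `P₀ ∈ E(K)`; `E(K[1])[2^M] = 0` transports `2^{M₀} ∥ P(1)` to `ord₂ [E(K):ℤP₀] = M₀`; the exact identity
`#Ш_an(W ⊗ K) = 4I²/(c²·w_K²·(∏c_q)²)` has `ord₂ = 2M₀ − 2t = ord₂ #Ш(E_K/K)`, i.e.
`MissingPPartOverCAt (W ⊗ K) 2`, and `AdditivePotMult.bsdp_of_pPartOverC_baseChange` concludes.
[cite: GrossZagier1986, V.§2 (pp. 310–312)] [cite: McCallumLMS1991, §5 Lemma 5.1]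
[cite: Milne1972ArithmeticAV, §1 Thm. 1] [cite: Miller2011LMS, Def. 1.1] -/
theorem bsdp_two_of_card_sha_baseChange_eq_shifted_of_facts
    (W : WeierstrassCurve ℚ) [W.IsElliptic] [W.IsGloballyMinimal] [NeZero (W.conductorNorm ℤ)]
    (K : Type) [Field K] [NumberField K]
    (Dt : ModularParametrizationData W (W.conductorNorm ℤ)) (β : ℤ) (ι : K →+* ℂ)
    (d₁ : KolyvaginHeegnerData Dt β ι 1)
    (Wd : WeierstrassCurve ℚ) [Wd.IsElliptic] [Wd.IsGloballyMinimal]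
    (hGZ : gross_zagier (W.conductorNorm ℤ) W K)
    (hGZK : rank_eq_analyticRank_of_analyticRank_le_one) (hmod : hasEntireLFunction_rat)
    (hMilneC : Milne1972.bsdQuotient_baseChange_quadratic_anyModel)
    (hρ : W.HasSurjectiveModNGaloisRep 2) (hr : W.analyticRank ≤ 1)
    (hK : IsImaginaryQuadratic K) (hodd : Odd (NumberField.discr K)) (h3 : NumberField.discr K ≠ -3)
    (hH : SatisfiesHeegnerHypothesis (W.conductorNorm ℤ) K) (hc : Odd Dt.c)
    (hrK : (W.baseChange K).analyticRank = 1) {M₀ : ℕ}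
    (hdiv : ∃ Q : (W.baseChange (ringClassField K ι 1)).toAffine.Point,
      ((2 ^ M₀ : ℕ) : ℤ) • Q = d₁.derivedPoint)
    (hndiv : ¬ ∃ Q : (W.baseChange (ringClassField K ι 1)).toAffine.Point,
      ((2 ^ (M₀ + 1) : ℕ) : ℤ) • Q = d₁.derivedPoint)
    (ht : padicValNat 2 W.tamagawaProduct ≤ M₀)
    (hsha : Nat.card (AddCommGroup.primaryComponent (W.baseChange K).sha 2) =
      2 ^ (2 * (M₀ - padicValNat 2 W.tamagawaProduct)))
    (hWd : ∃ C : VariableChange ℚ, C • W.quadraticTwist (NumberField.discr K : ℚ) = Wd)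
    (hrd : Wd.analyticRank ≤ 1) (hBd : BSDp Wd 2) : BSDp W 2 := by
  haveI : Fact (Nat.Prime 2) := ⟨Nat.prime_two⟩
  haveI hEK : (W.baseChange K).IsElliptic := isElliptic_baseChange' W K
  have h2 : Module.finrank ℚ K = 2 := hK.1
  obtain ⟨-, hDlt⟩ := discr_emod_four_and_lt_of_odd hK hodd h3
  have hw2 : Units.torsionOrder K = 2 :=
    Literature.NumberTheory.QuadraticFields.Quadratic.torsionOrder_eq_two_of_discr_lt_neg_four h2 hDlt
  have hc0 : Dt.c ≠ 0 := by
    obtain ⟨k, hk⟩ := hc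
    omega
  -- the Heegner point `P₀ ∈ E(K)` below `P(1)`, for the datum `Dt`
  obtain ⟨P₀, Hd, hP₀, hP₀K⟩ := exists_heegnerPoint_map_eq_derivedPoint_one hK hH d₁
  -- the exact identity over `K`
  obtain ⟨hrkK, hShaK, hPinf, hshaC⟩ := shaAnOverC_baseChange_eq_of_heegner W K Dt Hd ι P₀ hGZ
    hGZK hmod hK hH hP₀ hc0 hrK
  haveI hfinK : Finite (W.baseChange K).sha := hShaK
  -- `ord₂ [E(K) : ℤP₀] = M₀`
  have htor1 : ∀ (M : ℕ) (R : (W.baseChange (ringClassField K ι 1)).toAffine.Point),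
      ((2 ^ M : ℕ) : ℤ) • R = 0 → R = 0 :=
    fun M R hR ↦ eq_zero_of_two_pow_smul_eq_zero_ringClassField W hK hodd hH hρ ι M R hR
  have hdivK : ∃ Q : (W.baseChange K).toAffine.Point, ((2 ^ M₀ : ℕ) : ℤ) • Q = P₀ :=
    (X11b.Three.Koly.pDiv_one_iff_exists_zsmul_eq hK d₁ P₀ hP₀K 2 M₀ (htor1 M₀)).mp hdiv
  have hndivK : ¬ ∃ Q : (W.baseChange K).toAffine.Point, ((2 ^ (M₀ + 1) : ℕ) : ℤ) • Q = P₀ :=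
    fun h ↦ hndiv ((X11b.Three.Koly.pDiv_one_iff_exists_zsmul_eq hK d₁ P₀ hP₀K 2 (M₀ + 1)
      (htor1 (M₀ + 1))).mpr h)
  have hiv : ∀ x : (W.baseChange K).toAffine.Point, 2 • x = 0 → x = 0 :=
    fun x hx ↦ eq_zero_of_two_smul_eq_zero_baseChange W hK hodd hH hρ x hx
  haveI : Finite (AddCommGroup.torsion (W.baseChange K).toAffine.Point) :=
    WeierstrassCurve.finite_torsion_point (W := W.baseChange K)
  obtain ⟨cc, Q, hcQ, hcker⟩ :=
    X11b.RankOne.exists_coord_of_mordellWeilRank_eq_one (W.baseChange K) hrkK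
  have hidx : padicValNat 2 (AddSubgroup.zmultiples P₀).index = M₀ :=
    X11b.Three.Koly.padicValNat_index_zmultiples_eq_of_divisibility (p := 2) cc Q hcQ hcker hiv P₀
      hdivK hndivK
  -- `ord₂ #Ш_an(W ⊗ K) = 2 M₀ − 2 t = ord₂ #Ш(W ⊗ K)`
  set t := padicValNat 2 W.tamagawaProduct with ht_def
  set I := (AddSubgroup.zmultiples P₀).index with hI_def
  have hI0 : I ≠ 0 := fun hI ↦ by
    have hh := P2.torsionOrder_sq_mul_canonicalHeight_eq_index_sq_mul_regulator (W.baseChange K)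
      hrkK P₀ hPinf
    rw [← hI_def, hI, Nat.cast_zero, zero_pow two_ne_zero, zero_mul, mul_eq_zero,
      pow_eq_zero_iff two_ne_zero, Nat.cast_eq_zero] at hh
    exact hh.elim (W.baseChange K).torsionOrder_pos_holds.ne'
      (fun h0 ↦ hPinf ((Affine.Point.canonicalHeight_eq_zero_iff_holds P₀).mp h0))
  set q : ℚ := 4 * (I : ℚ) ^ 2 /
      ((Dt.c : ℚ) ^ 2 * (Units.torsionOrder K : ℚ) ^ 2 * ((W.tamagawaProduct : ℚ) ^ 2)) with hq_def
  have hcQ0 : (Dt.c : ℚ) ≠ 0 := by exact_mod_cast hc0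
  have hcW0 : (W.tamagawaProduct : ℚ) ≠ 0 := by exact_mod_cast W.tamagawaProduct_pos_holds.ne'
  have hIQ0 : (I : ℚ) ≠ 0 := by exact_mod_cast hI0
  have hq' : q = ((I : ℚ) / ((Dt.c : ℚ) * (W.tamagawaProduct : ℚ))) ^ 2 := by
    rw [hq_def, hw2]
    push_cast
    field_simp
    ring
  have hvc : padicValRat 2 (Dt.c : ℚ) = 0 := by
    rw [padicValRat.of_int, padicValInt.eq_zero_of_not_dvd (fun h2c ↦
      (Int.not_even_iff_odd.mpr hc) (even_iff_two_dvd.mpr h2c))]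
    rfl
  have hvcW : padicValRat 2 (W.tamagawaProduct : ℚ) = (t : ℤ) := by
    rw [padicValRat.of_nat]
  have hval : padicValRat 2 q = 2 * (M₀ : ℤ) - 2 * (t : ℤ) := by
    rw [hq', padicValRat.pow, padicValRat.div hIQ0 (mul_ne_zero hcQ0 hcW0),
      padicValRat.mul hcQ0 hcW0, hvc, hvcW, padicValRat.of_nat, hidx]
    push_cast
    ring
  have hshaV : padicValNat 2 (W.baseChange K).shaOrder = 2 * (M₀ - t) := by
    rw [X11b.Three.Koly.padicValNat_shaOrder_eq (W.baseChange K) 2, hsha, padicValNat.prime_pow]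
  have hKin : MissingPPartOverCAt (W.baseChange K) 2 :=
    ⟨q, hshaC, by rw [hval, hshaV]; push_cast [Nat.cast_sub ht]; ring⟩
  exact bsdp_of_pPartOverC_baseChange W 2 K Wd hGZK hmod hMilneC hr h2 hWd hrd hKin hBd

/-! ## §2 The twin of the rank-zero member has analytic rank exactly one — no Kolyvagin, no `#Sel₂` -/

/-- **The twin of the rank-zero member has analytic rank EXACTLY one, from Gross–Zagier, GZK and
modularity alone.** `W/ℚ` globally minimal with `r_an(E) = 0`; `K` imaginary quadratic with the Heegner
hypothesis for `N_E`; `P₀ ∈ E(K)` a Heegner point (of a datum at level `N_E`) of infinite order. Then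
`ord_{s=1} L(E^{(d_K)}, s) = 1`: `P₀` gives `rank E(K) ≥ 1`; GZK at `r_an(E) = 0` gives `rank E(ℚ) = 0`,
so `rank E^{(d_K)}(ℚ) = rank E(K) − rank E(ℚ) ≥ 1` (`mordellWeilRank_baseChange_quadratic_holds`); hence
`L(E^{(d_K)}, 1) = 0` (else GZK would give rank `0`); Gross–Zagier at `P₀` gives `L′(E/K, 1) ≠ 0`, and
`L′(E/K, 1) = L(E, 1) · L′(E^{(d_K)}, 1)` makes the zero simple. Neither Kolyvagin's theorem over `K` (used
by `analyticRank_twist_eq_one_of_rankZero`) nor a `#Sel₂ = 2` binder (used by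
`analyticRank_twin_eq_one_of_binders`) is needed. [cite: GrossZagier1986, Thm. I.6.3 and V.§2]
[cite: Darmon2004, Thm. 3.22] [cite: SilvermanAEC2009, Thm. VIII.6.7] -/
theorem analyticRank_twist_eq_one_of_rankZero_of_heegner
    (W : WeierstrassCurve ℚ) [W.IsElliptic] [W.IsGloballyMinimal] [NeZero (W.conductorNorm ℤ)]
    (K : Type) [Field K] [NumberField K]
    (hGZ : gross_zagier (W.conductorNorm ℤ) W K)
    (hGZK : rank_eq_analyticRank_of_analyticRank_le_one) (hmod : hasEntireLFunction_rat)
    (hK : IsImaginaryQuadratic K) (hH : SatisfiesHeegnerHypothesis (W.conductorNorm ℤ) K)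
    (hr0 : W.analyticRank = 0) {P₀ : (W.baseChange K).toAffine.Point}
    (hP₀ : IsHeegnerPoint (W.conductorNorm ℤ) W K P₀) (hPinf : ¬ IsOfFinAddOrder P₀) :
    (W.quadraticTwist (NumberField.discr K : ℚ)).analyticRank = 1 := by
  haveI hEK : (W.baseChange K).IsElliptic := isElliptic_baseChange' W K
  have h2 : Module.finrank ℚ K = 2 := hK.1
  have hD0 : (NumberField.discr K : ℚ) ≠ 0 := by exact_mod_cast NumberField.discr_ne_zero K
  haveI hEt : (W.quadraticTwist (NumberField.discr K : ℚ)).IsElliptic :=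
    W.isElliptic_quadraticTwist hD0
  have hLK : LDerivEK W K ≠ 0 :=
    (lDerivEK_ne_zero_iff_not_isOfFinAddOrder W (W.conductorNorm ℤ) K hGZ hK hH hP₀).mpr hPinf
  have hrankW : W.mordellWeilRank = 0 := by
    have h := (hGZK W (by rw [hr0]; exact zero_le_one)).1
    rw [h, hr0]
  have hK1 : 1 ≤ (W.baseChange K).mordellWeilRank :=
    one_le_mordellWeilRank_of_not_isOfFinAddOrder (W.baseChange K) hPinf
  have hsum := mordellWeilRank_baseChange_quadratic_holds W K h2
  have hrankt : 1 ≤ (W.quadraticTwist (NumberField.discr K : ℚ)).mordellWeilRank := by omega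
  have hLt0 : (W.quadraticTwist (NumberField.discr K : ℚ)).entireLFunction 1 = 0 := by
    by_contra hne
    have hrt0 : (W.quadraticTwist (NumberField.discr K : ℚ)).analyticRank = 0 :=
      ((W.quadraticTwist _).analyticRank_eq_zero_iff_holds (hmod _)).mpr hne
    have h := (hGZK (W.quadraticTwist (NumberField.discr K : ℚ)) (by rw [hrt0]; exact zero_le_one)).1
    omega
  have hder : deriv (W.quadraticTwist (NumberField.discr K : ℚ)).entireLFunction 1 ≠ 0 := by
    intro hd
    apply hLK
    rw [AnticyclotomicRankZero.lDerivEK_eq_mul_deriv hmod W K hLt0, hd, mul_zero]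
  exact analyticRank_eq_one_of_entireLFunction_one_eq_zero_of_deriv_ne_zero _ (hmod _) hLt0 hder

/-! ## §3 The item, closed modulo the four published facts -/

/-- **`ShiftedExactDescentAtTwo` (item 27470) MODULO FOUR PUBLISHED INPUTS** — Gross–Zagier AT THE
ITEM'S TRIPLE `(N_E, W, K)` (`hGZ`), Gross–Zagier–Kolyvagin over `ℚ` (`hGZK`), modularity (`hmod`), Milne
1972 Thm 1 any-model (`hMilneC`). For the rank-ZERO member: `P(1)` descends to a non-torsion `P₀ ∈ E(K)`
(`exists_heegnerPoint_map_eq_derivedPoint_one`); the twin has `r_an(Wd) = 1` by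
`analyticRank_twist_eq_one_of_rankZero_of_heegner`, so `ord_{s=1} L(E_K, s) = 1`
(`P2.analyticRank_baseChange_eq_one_iff`); then §1's shifted descent
`bsdp_two_of_card_sha_baseChange_eq_shifted_of_facts` gives `BSD(W, 2)`. The non-CM hypothesis and the
optimality display of `Dt` are idle. CONDITIONAL on the four named facts (none has a `_holds`); closes item
27470 only through an `…OfFourFacts` twin (planner). [cite: GrossZagier1986, V.§2 (pp. 310–312)]
[cite: Milne1972ArithmeticAV, §1 Thm. 1] [cite: McCallumLMS1991, §5 Lemma 5.1] [cite: Miller2011LMS, Def. 1.1] -/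
theorem shiftedExactDescentAtTwo_of_four_facts
    (hGZ : ∀ (W : WeierstrassCurve ℚ) [NeZero (W.conductorNorm ℤ)] (K : Type) [Field K]
      [NumberField K], gross_zagier (W.conductorNorm ℤ) W K)
    (hGZK : rank_eq_analyticRank_of_analyticRank_le_one) (hmod : hasEntireLFunction_rat)
    (hMilneC : Milne1972.bsdQuotient_baseChange_quadratic_anyModel) :
    Summit.BirchSwinnertonDyer.BirchSwinnertonDyer.Theses.GenusKolyvaginAtTwo.ShiftedExactDescentAtTwo := by
  intro W _ _ _ _hcm hr0 hρ K _ _ hK hodd h3 hH Dt _hopt hc β ι d₁ hy M₀ hdiv hndiv ht hsha Wd _ _ hWd hBd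
  haveI hEK : (W.baseChange K).IsElliptic := isElliptic_baseChange' W K
  have h2 : Module.finrank ℚ K = 2 := hK.1
  have hD0 : (NumberField.discr K : ℚ) ≠ 0 := by exact_mod_cast NumberField.discr_ne_zero K
  haveI hEt : (W.quadraticTwist (NumberField.discr K : ℚ)).IsElliptic :=
    W.isElliptic_quadraticTwist hD0
  have hρ2 : W.HasSurjectiveModNGaloisRep 2 := by
    simpa using hρ 1 one_pos
  -- the Heegner point `P₀ ∈ E(K)` below `P(1)` is non-torsion
  obtain ⟨P₀, Hd, hP₀, hP₀K⟩ := exists_heegnerPoint_map_eq_derivedPoint_one hK hH d₁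
  have hPinf : ¬ IsOfFinAddOrder P₀ := by
    intro hfin
    apply hy
    rw [← hP₀K]
    exact (WeierstrassCurve.Affine.Point.map (W' := W)
      (algebraMap K (ringClassField K ι 1)).toRatAlgHom).isOfFinAddOrder hfin
  -- the twin has analytic rank exactly one (GZ + GZK + modularity; no Kolyvagin, no `#Sel₂`)
  have hrt : (W.quadraticTwist (NumberField.discr K : ℚ)).analyticRank = 1 :=
    analyticRank_twist_eq_one_of_rankZero_of_heegner W K (hGZ W K) hGZK hmod hK hH hr0
      ⟨Dt, Hd, ι, hP₀⟩ hPinf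
  have hrd : Wd.analyticRank = 1 := by
    obtain ⟨Cd, hCd⟩ := hWd
    rw [← hCd, analyticRank_smul, hrt]
  have hrK : (W.baseChange K).analyticRank = 1 :=
    (P2.analyticRank_baseChange_eq_one_iff W K hmod h2).mpr (Or.inr ⟨hr0, hrt⟩)
  exact bsdp_two_of_card_sha_baseChange_eq_shifted_of_facts W K Dt β ι d₁ Wd (hGZ W K) hGZK hmod
    hMilneC hρ2 (by rw [hr0]; exact zero_le_one) hK hodd h3 hH hc hrK hdiv hndiv ht hsha hWd hrd.le hBd

/-- **Item 27470 RELATIVE TO the four-fact bundle of item 24238** — VERBATIM the antecedent of the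
closed `ExactDescentAtTwoOfFourFacts` (and of the CM sibling's `cmExactDescentAtTwo_ofFacts`):
`(∀ N W K, gross_zagier N W K) ∧ GZK ∧ modularity ∧ Milne any-model → ShiftedExactDescentAtTwo`. One
`…OfFourFacts` antecedent serves the main line's descent crux #4 and LINE 9's descent node J4 alike.
[cite: Miller2011LMS, Def. 1.1] -/
theorem shiftedExactDescentAtTwo_ofFourFacts :
    ((∀ (N : ℕ) [NeZero N] (W : WeierstrassCurve ℚ) (K : Type) [Field K] [NumberField K],
        gross_zagier N W K) ∧
      rank_eq_analyticRank_of_analyticRank_le_one ∧ hasEntireLFunction_rat ∧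
      Milne1972.bsdQuotient_baseChange_quadratic_anyModel) →
    Summit.BirchSwinnertonDyer.BirchSwinnertonDyer.Theses.GenusKolyvaginAtTwo.ShiftedExactDescentAtTwo :=
  fun h ↦ shiftedExactDescentAtTwo_of_four_facts (fun W _ K _ _ ↦ h.1 _ W K) h.2.1 h.2.2.1 h.2.2.2

/-- **The curried four-fact closer** (binder shape of `exactDescentAtTwo_of_four_facts'`: `hGZ : ∀ N W K,
gross_zagier N W K`, then GZK, modularity, Milne any-model), for a by-name closer of an `…OfFourFacts`
restatement of item 27470 typed with Gross–Zagier quantified over all levels `N`.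
[cite: Miller2011LMS, Def. 1.1] -/
theorem shiftedExactDescentAtTwo_of_four_facts'
    (hGZ : ∀ (N : ℕ) [NeZero N] (W : WeierstrassCurve ℚ) (K : Type) [Field K] [NumberField K],
      gross_zagier N W K)
    (hGZK : rank_eq_analyticRank_of_analyticRank_le_one) (hmod : hasEntireLFunction_rat)
    (hMilneC : Milne1972.bsdQuotient_baseChange_quadratic_anyModel) :
    Summit.BirchSwinnertonDyer.BirchSwinnertonDyer.Theses.GenusKolyvaginAtTwo.ShiftedExactDescentAtTwo :=
  shiftedExactDescentAtTwo_of_four_facts (fun W _ K _ _ ↦ hGZ _ W K) hGZK hmod hMilneC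

/-! ## §4 Unconditional comparisons and the LINE 9 reading -/

/-- **The shifted descent is the STRONGER statement: `ShiftedExactDescentAtTwo → ExactDescentAtTwo`,
unconditionally.** Under crux #4's binder `Odd ∏_q c_q(E)` the shift is `t = ord₂ ∏_q c_q = 0`
(`padicValNat.eq_zero_of_not_dvd`), so `t ≤ M₀` holds trivially and the exactness input
`#Ш(E_K)[2^∞] = 4^{M₀}` is the shifted one `4^{M₀ − t}`; crux #4's extra binder `#Sel₂(Wd) = 2` is simply
not passed on. Pure logic over the route's own statements; credits nothing by itself. [folklore] -/
theorem exactDescentAtTwo_of_shifted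
    (hS : Summit.BirchSwinnertonDyer.BirchSwinnertonDyer.Theses.GenusKolyvaginAtTwo.ShiftedExactDescentAtTwo) :
    Summit.BirchSwinnertonDyer.BirchSwinnertonDyer.Theses.GenusKolyvaginAtTwo.ExactDescentAtTwo := by
  intro W _ _ _ hcm hr0 hρ hT K _ _ hK hodd h3 hH Dt hopt hc β ι d₁ hy M₀ hdiv hndiv hsha Wd _ _ hWd
    _hSel hBd
  have ht0 : padicValNat 2 W.tamagawaProduct = 0 :=
    padicValNat.eq_zero_of_not_dvd hT.not_two_dvd_nat
  exact hS W hcm hr0 hρ K hK hodd h3 hH Dt hopt hc β ι d₁ hy M₀ hdiv hndiv (by rw [ht0]; exact Nat.zero_le _)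
    (by rw [ht0, Nat.sub_zero]; exact hsha) Wd hWd hBd

-- Consistency check at `t = 0` (not re-declared: its type is the landed `exactDescentAtTwo_ofFourFacts`):
-- `fun h ↦ exactDescentAtTwo_of_shifted (shiftedExactDescentAtTwo_ofFourFacts h)` re-proves crux #4
-- modulo the four facts through the shifted road.
example :
    ((∀ (N : ℕ) [NeZero N] (W : WeierstrassCurve ℚ) (K : Type) [Field K] [NumberField K],
        gross_zagier N W K) ∧
      rank_eq_analyticRank_of_analyticRank_le_one ∧ hasEntireLFunction_rat ∧
      Milne1972.bsdQuotient_baseChange_quadratic_anyModel) →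
    Summit.BirchSwinnertonDyer.BirchSwinnertonDyer.Theses.GenusKolyvaginAtTwo.ExactDescentAtTwo :=
  fun h ↦ exactDescentAtTwo_of_shifted (shiftedExactDescentAtTwo_ofFourFacts h)

/-- **LINE 9 MODULO PRINT.** Granted the four published facts (bundle of
`shiftedExactDescentAtTwo_ofFourFacts`), J4 `ShiftedExactDescentAtTwo` drops out of the LINE 9 glue
`OffHabitatResidualAtTwoOfShift` (item 27472, closed by `offHabitatResidualAtTwoOfShift_proof`): the
residual #5 `OffHabitatResidualAtTwo` follows from J1 `TamagawaDivisibilityAtTwo`, J2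
`ShiftedGenusSupplyAtTwo`, J3 `KolyvaginExactAtTwoShifted` and the declared residual R′
`OffShiftedHabitatResidualAtTwo` alone — LINE 9's open content is {J1, J2, J3, R′}. CONDITIONAL (every
antecedent is an open item or a named fact); BSD is not proved by this. [cite: Miller2011LMS, Def. 1.1] -/
theorem offHabitatResidualAtTwo_of_four_facts_of_shiftCruxes
    (hfacts : (∀ (N : ℕ) [NeZero N] (W : WeierstrassCurve ℚ) (K : Type) [Field K] [NumberField K],
        gross_zagier N W K) ∧
      rank_eq_analyticRank_of_analyticRank_le_one ∧ hasEntireLFunction_rat ∧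
      Milne1972.bsdQuotient_baseChange_quadratic_anyModel)
    (hJ1 : Summit.BirchSwinnertonDyer.BirchSwinnertonDyer.Theses.GenusKolyvaginAtTwo.TamagawaDivisibilityAtTwo)
    (hJ2 : Summit.BirchSwinnertonDyer.BirchSwinnertonDyer.Theses.GenusKolyvaginAtTwo.ShiftedGenusSupplyAtTwo)
    (hJ3 : Summit.BirchSwinnertonDyer.BirchSwinnertonDyer.Theses.GenusKolyvaginAtTwo.KolyvaginExactAtTwoShifted)
    (hR' : Summit.BirchSwinnertonDyer.BirchSwinnertonDyer.Theses.GenusKolyvaginAtTwo.OffShiftedHabitatResidualAtTwo) :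
    Summit.BirchSwinnertonDyer.BirchSwinnertonDyer.Theses.GenusKolyvaginAtTwo.OffHabitatResidualAtTwo :=
  Summit.BirchSwinnertonDyer.BirchSwinnertonDyer.Theses.GenusKolyvaginAtTwo.offHabitatResidualAtTwoOfShift_proof
    hJ1 hJ2 hJ3 (shiftedExactDescentAtTwo_ofFourFacts hfacts) hR'

/-- **THE WHOLE LEAF MODULO PRINT, with the residual split along LINE 9.** Granted the four published
facts, the registered leaf `Rank1Residual.NonCMAtTwo` (rung K4) follows from the main line's crux #2
`GenusPrimitiveSupplyAtTwo`, crux #3 `KolyvaginExactAtTwo`, crux #6 `MinimalTwinBSDTwo` and LINE 9's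
J1, J2, J3, R′ — both descent nodes (crux #4 and J4) are print-complete and both glues are closed.
CONDITIONAL (credits nothing; every antecedent is an open item or a named fact); BSD is not proved by
this. [cite: Miller2011LMS, Def. 1.1] -/
theorem nonCMAtTwo_of_four_facts_of_cruxes_of_shiftCruxes
    (hfacts : (∀ (N : ℕ) [NeZero N] (W : WeierstrassCurve ℚ) (K : Type) [Field K] [NumberField K],
        gross_zagier N W K) ∧
      rank_eq_analyticRank_of_analyticRank_le_one ∧ hasEntireLFunction_rat ∧
      Milne1972.bsdQuotient_baseChange_quadratic_anyModel)
    (hP : Summit.BirchSwinnertonDyer.BirchSwinnertonDyer.Theses.GenusKolyvaginAtTwo.GenusPrimitiveSupplyAtTwo)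
    (hX : Summit.BirchSwinnertonDyer.BirchSwinnertonDyer.Theses.GenusKolyvaginAtTwo.KolyvaginExactAtTwo)
    (hTw : Summit.BirchSwinnertonDyer.BirchSwinnertonDyer.Theses.GenusKolyvaginAtTwo.MinimalTwinBSDTwo)
    (hJ1 : Summit.BirchSwinnertonDyer.BirchSwinnertonDyer.Theses.GenusKolyvaginAtTwo.TamagawaDivisibilityAtTwo)
    (hJ2 : Summit.BirchSwinnertonDyer.BirchSwinnertonDyer.Theses.GenusKolyvaginAtTwo.ShiftedGenusSupplyAtTwo)
    (hJ3 : Summit.BirchSwinnertonDyer.BirchSwinnertonDyer.Theses.GenusKolyvaginAtTwo.KolyvaginExactAtTwoShifted)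
    (hR' : Summit.BirchSwinnertonDyer.BirchSwinnertonDyer.Theses.GenusKolyvaginAtTwo.OffShiftedHabitatResidualAtTwo) :
    Summit.BirchSwinnertonDyer.BirchSwinnertonDyer.Rank1Residual.NonCMAtTwo :=
  nonCMAtTwo_of_four_facts_of_cruxes hfacts hP hX
    (offHabitatResidualAtTwo_of_four_facts_of_shiftCruxes hfacts hJ1 hJ2 hJ3 hR') hTw

end Summit.BirchSwinnertonDyer.BirchSwinnertonDyer.Theorems.GenusExactDescent

end
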